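import Mathlib
import HarnessLib
import Literature.Computability.AlgebraicComplexity.NilCoxeterTensor
import Literature.Computability.AlgebraicComplexity.BorderRankFlattening

/-!
# The flattening floor `n! ≤ bR(T_{NC_n})` — stub `stub_flatteningFloor` of line `birth`
(crux `AThesis`, stmt-MatrixMultiplication-0956, route `NilCoxeterShadow`)

The structure tensor `T_{NC_n} = nilCoxeterTensor ℂ n` of the nil-Coxeter algebra `NC_n` (index
order `(z, x, y)` = (output, left factor, right factor)) is concise in the output slot: `NC_n` is
unital, `T_e T_w = T_w` (`nilCoxeterTensor_one_left`), so the output slice of `z` is the only one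
with a non-zero entry at `(x, y) = (e, z)`.  Hence the `n! = |S_n|` output slices are linearly
independent over `ℂ` (`linearIndependent_nilCoxeterTensor`), and the slice (flattening) lower bound
for the border rank over `ℂ[ε]` (`card_le_algBorderRank_of_linearIndependent`, Bläser 2013,
Lemma 7.1(2), proof) gives `n! ≤ bR(T_{NC_n})` (`stub_flatteningFloor`).  In the line this floor
supplies the positivity / size of the border-rank sequence at the start of the induction along the
parabolic tower `NC_n ⊂ NC_{n+1}`.
-/

-- single-conjunct summit: the mandated namespace repeats `MatrixMultiplication`.
set_option linter.dupNamespace false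

noncomputable section

open scoped BigOperators
open Literature.Computability.AlgebraicComplexity

namespace Summit.MatrixMultiplication.MatrixMultiplication.Theorems.AThesis

/-- **Conciseness of `T_{NC_n}` in the output slot**: the output slices
`z ↦ T_{NC_n}(z, ·, ·)` are linearly independent over the field `K`, because the slice of `z` has
entry `1` at `(x, y) = (e, z)` (`T_e T_z = T_z`) while every other slice vanishes there.
[cite: Blaser2013, Lemma 7.1(2) (proof)] -/
theorem linearIndependent_nilCoxeterTensor (K : Type*) [Field K] (n : ℕ) :
    LinearIndependent K (fun z => nilCoxeterTensor K n z :
      Equiv.Perm (Fin n) → Equiv.Perm (Fin n) → Equiv.Perm (Fin n) → K) := by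
  rw [Fintype.linearIndependent_iff]
  intro g hg z₀
  -- evaluate the dependency `∑ z, g z • T(z, ·, ·) = 0` at `(x, y) = (e, z₀)`
  have h := congr_fun (congr_fun hg 1) z₀
  rw [Finset.sum_apply, Finset.sum_apply,
    Finset.sum_eq_single_of_mem z₀ (Finset.mem_univ _)] at h
  · simpa [nilCoxeterTensor_one_left] using h
  · intro z _ hne
    simp only [Pi.smul_apply, smul_eq_mul, nilCoxeterTensor_one_left, if_neg (Ne.symm hne),
      mul_zero]

/-- **Stub 1 of line `birth` — the flattening floor `n! ≤ bR(T_{NC_n})`.** The `n!` output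
slices of the structure tensor of the unital algebra `NC_n` are linearly independent
(`linearIndependent_nilCoxeterTensor`), so the slice lower bound for the border rank over `ℂ[ε]`
(`card_le_algBorderRank_of_linearIndependent`) gives `|S_n| = n! ≤ bR(T_{NC_n})`.
[cite: Blaser2013, Lemma 7.1(2) (proof)] -/
theorem stub_flatteningFloor : ∀ n : ℕ, n.factorial ≤ algBorderRank (nilCoxeterTensor ℂ n) := by
  intro n
  have h := card_le_algBorderRank_of_linearIndependent (nilCoxeterTensor ℂ n)
    (linearIndependent_nilCoxeterTensor ℂ n)
  rwa [Fintype.card_perm, Fintype.card_fin] at h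

end Summit.MatrixMultiplication.MatrixMultiplication.Theorems.AThesis

end
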